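import Literature.MeasureTheory.Lebesgue.LipschitzShearSubstitution
import Mathlib.MeasureTheory.Measure.Haar.InnerProductSpace
import Mathlib.MeasureTheory.Measure.Prod
import HarnessLib

/-!
# Change of variables for shears along a fixed direction: the product and the planar case

Topic `Literature/MeasureTheory/Lebesgue` (namespace `Literature.MeasureTheory.Lebesgue`),
continuation of `LipschitzShearSubstitution.lean`. Richthammer's density computation for the
deformed Poisson process [Richthammer2007, §6.6] substitutes one particle coordinate at a time,
`x'_i := x_i + t(x_i) e₁`, where for every fixed transverse coordinate `r̄` the map
`r ↦ t(r, r̄)` is `1/2`-Lipschitz: "the transformation only concerns the first component of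
`x_i = (r_i, r̄_i)`. For fixed `r̄_i`, `r_i` is transformed by `id + t(., r̄_i)` … so the
Lebesgue transformation theorem (6.1) gives `dx'_i = dx_i |1 + ∂₁ t(x_i)|`". This file proves
that step, with the everywhere-defined Jacobian factor `1 + seqDeriv`:

* `lintegral_shear_prod` — on `ℝ × Y` (`Y` any s-finite measure space): for measurable
  `t : ℝ × Y → ℝ` with `t(·, y)` `L`-Lipschitz, `L < 1`, and measurable `u ≥ 0`,
  `∫ (1 + seqDeriv t(·,y)(a)) u(a + t(a,y), y) = ∫ u` against `volume ⊗ ν` (Tonelli + the 1-D rule);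
* `planarSplit` facts and `lintegral_planarShear` — the same on `ℝ² = EuclideanSpace ℝ (Fin 2)`
  for shears `p ↦ p + t(p) e₁`, `e₁ = EuclideanSpace.single 0 1`, with `t` Lipschitz (`< 1`)
  along every line `p + ℝ e₁`; the Jacobian factor is
  `1 + ∂₁ᵉ t(p) := 1 + seqDeriv (r ↦ t(p + r e₁)) 0`.

## References

* [Richthammer2007] T. Richthammer, *Translation-invariance of two-dimensional Gibbsian point
  processes*, Comm. Math. Phys. 274 (2007) 81–122, arXiv:0706.3637: §6.2 (6.1) (p. 13), §6.6
  (p. 16).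
-/

noncomputable section

namespace Literature.MeasureTheory.Lebesgue

open _root_.MeasureTheory Filter Set Function
open scoped ENNReal NNReal Topology

/-! ### Shears of a product `ℝ × Y` along the first factor -/

/-- `seqDeriv` is translation-equivariant: the sequential difference quotient of `r ↦ t(a + r)`
at `0` is that of `t` at `a`. [folklore] -/
theorem seqDeriv_comp_const_add (t : ℝ → ℝ) (a : ℝ) :
    seqDeriv (fun r => t (a + r)) 0 = seqDeriv t a := by
  simp only [seqDeriv, zero_add, add_zero]

/-- Joint measurability of the Jacobian factor `(a, y) ↦ seqDeriv t(·, y) (a)` for a jointly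
measurable `t`. [folklore] -/
theorem measurable_seqDeriv_prod {Y : Type*} [MeasurableSpace Y] {t : ℝ × Y → ℝ}
    (ht : Measurable t) : Measurable fun q : ℝ × Y => seqDeriv (fun a => t (a, q.2)) q.1 := by
  simp only [seqDeriv_def]
  refine Measurable.liminf fun m => ?_
  exact measurable_const.mul
    ((ht.comp ((measurable_fst.add_const _).prodMk measurable_snd)).sub ht)

/-- **Change of variables for a shear of `ℝ × Y` along `ℝ`.** For a jointly measurable
`t : ℝ × Y → ℝ` such that every `t(·, y)` is Lipschitz with constant `L < 1`, and every
measurable `u : ℝ × Y → [0, ∞]`,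
`∫ (1 + seqDeriv t(·, y) (a)) u(a + t(a, y), y) d(vol ⊗ ν) = ∫ u d(vol ⊗ ν)`
(Tonelli in `y`, then the one-dimensional rule). [cite: Richthammer2007, §6.6 (p. 16)] -/
theorem lintegral_shear_prod {Y : Type*} [MeasurableSpace Y] (ν : Measure Y) [SFinite ν]
    {L : ℝ≥0} {t : ℝ × Y → ℝ} (ht : Measurable t) (hL : ∀ y, LipschitzWith L fun a => t (a, y))
    (hL1 : L < 1) {u : ℝ × Y → ℝ≥0∞} (hu : Measurable u) :
    ∫⁻ q, ENNReal.ofReal (1 + seqDeriv (fun a => t (a, q.2)) q.1) * u (q.1 + t q, q.2)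
        ∂((volume : Measure ℝ).prod ν) =
      ∫⁻ q, u q ∂((volume : Measure ℝ).prod ν) := by
  have hG : Measurable fun q : ℝ × Y =>
      ENNReal.ofReal (1 + seqDeriv (fun a => t (a, q.2)) q.1) * u (q.1 + t q, q.2) :=
    (ENNReal.measurable_ofReal.comp (measurable_const.add (measurable_seqDeriv_prod ht))).mul
      (hu.comp ((measurable_fst.add ht).prodMk measurable_snd))
  rw [lintegral_prod_symm _ hG.aemeasurable, lintegral_prod_symm _ hu.aemeasurable]
  refine lintegral_congr fun y => ?_
  exact lintegral_one_add_seqDeriv_mul_comp (hL y) hL1 fun a => u (a, y)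

/-! ### The planar case: shears of `ℝ²` along `e₁` -/

/-- The coordinate splitting `ℝ² ≃ᵐ ℝ × ℝ`, `p ↦ (p₀, p₁)`. [folklore] -/
def planarSplit : EuclideanSpace ℝ (Fin 2) ≃ᵐ ℝ × ℝ :=
  (MeasurableEquiv.toLp 2 (Fin 2 → ℝ)).symm.trans MeasurableEquiv.finTwoArrow

/-- `planarSplit p = (p 0, p 1)`. [folklore] -/
theorem planarSplit_apply (p : EuclideanSpace ℝ (Fin 2)) : planarSplit p = (p 0, p 1) := by
  simp [planarSplit, MeasurableEquiv.finTwoArrow]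

/-- `planarSplit⁻¹ (a, b) = a e₀ + b e₁`. [folklore] -/
theorem planarSplit_symm_apply (q : ℝ × ℝ) :
    planarSplit.symm q = EuclideanSpace.single 0 q.1 + EuclideanSpace.single 1 q.2 := by
  apply planarSplit.injective
  rw [MeasurableEquiv.apply_symm_apply, planarSplit_apply]
  ext <;> simp

/-- `planarSplit` preserves Lebesgue measure. [folklore] -/
theorem measurePreserving_planarSplit :
    MeasurePreserving planarSplit (volume : Measure (EuclideanSpace ℝ (Fin 2)))
      ((volume : Measure ℝ).prod volume) :=
  (EuclideanSpace.volume_preserving_symm_measurableEquiv_toLp (Fin 2)).trans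
    (volume_preserving_finTwoArrow ℝ)

/-- Moving along `e₁` is adding to the first split coordinate:
`planarSplit⁻¹(a, b) + r e₁ = planarSplit⁻¹(a + r, b)`. [folklore] -/
theorem planarSplit_symm_add_smul (a b r : ℝ) :
    planarSplit.symm (a, b) + r • EuclideanSpace.single 0 (1 : ℝ) = planarSplit.symm (a + r, b) := by
  rw [planarSplit_symm_apply, planarSplit_symm_apply]
  ext i
  fin_cases i <;> simp

/-- **Change of variables for a planar shear along `e₁`.** Let `t : ℝ² → ℝ` be measurable and
Lipschitz with constant `L < 1` along every line `p + ℝ e₁`. Then for every measurable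
`u : ℝ² → [0, ∞]`,
`∫ (1 + ∂₁ᵉt(p)) u(p + t(p) e₁) dp = ∫ u(p') dp'`, where `∂₁ᵉt(p) = seqDeriv (r ↦ t(p + r e₁)) 0`
is the (everywhere defined, measurable) sequential partial difference quotient in direction
`e₁`: "for fixed `r̄_i`, `r_i` is transformed by `id + t(., r̄_i)` … `dx'_i = dx_i |1 + ∂₁t(x_i)|`".
[cite: Richthammer2007, §6.6 (p. 16), with §6.2 (6.1)] -/
theorem lintegral_planarShear {L : ℝ≥0} {t : EuclideanSpace ℝ (Fin 2) → ℝ} (ht : Measurable t)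
    (hL : ∀ p, LipschitzWith L fun r : ℝ => t (p + r • EuclideanSpace.single 0 (1 : ℝ)))
    (hL1 : L < 1) {u : EuclideanSpace ℝ (Fin 2) → ℝ≥0∞} (hu : Measurable u) :
    ∫⁻ p, ENNReal.ofReal (1 + seqDeriv (fun r => t (p + r • EuclideanSpace.single 0 (1 : ℝ))) 0) *
        u (p + t p • EuclideanSpace.single 0 (1 : ℝ)) =
      ∫⁻ p, u p := by
  -- transport to `ℝ × ℝ`
  set t' : ℝ × ℝ → ℝ := fun q => t (planarSplit.symm q) with ht'
  set u' : ℝ × ℝ → ℝ≥0∞ := fun q => u (planarSplit.symm q) with hu'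
  have ht'm : Measurable t' := ht.comp planarSplit.symm.measurable
  have hu'm : Measurable u' := hu.comp planarSplit.symm.measurable
  have hL' : ∀ b, LipschitzWith L fun a => t' (a, b) := fun b => by
    have h := hL (planarSplit.symm (0, b))
    have heq : (fun r : ℝ => t (planarSplit.symm (0, b) + r • EuclideanSpace.single 0 (1 : ℝ))) =
        fun a => t' (a, b) := by
      funext r
      rw [planarSplit_symm_add_smul, zero_add]
    rwa [heq] at h
  have hsymm := measurePreserving_planarSplit.symm planarSplit
  -- the integrand transported
  have key : ∀ q : ℝ × ℝ,
      ENNReal.ofReal (1 + seqDeriv (fun r => t (planarSplit.symm q +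
          r • EuclideanSpace.single 0 (1 : ℝ))) 0) *
        u (planarSplit.symm q + t (planarSplit.symm q) • EuclideanSpace.single 0 (1 : ℝ)) =
      ENNReal.ofReal (1 + seqDeriv (fun a => t' (a, q.2)) q.1) * u' (q.1 + t' q, q.2) := by
    rintro ⟨a, b⟩
    have h1 : (fun r => t (planarSplit.symm (a, b) + r • EuclideanSpace.single 0 (1 : ℝ))) =
        fun r => (fun a' => t' (a', b)) (a + r) := by
      funext r
      rw [planarSplit_symm_add_smul]
    rw [h1, seqDeriv_comp_const_add (fun a' => t' (a', b)) a, planarSplit_symm_add_smul]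
  calc ∫⁻ p, ENNReal.ofReal (1 + seqDeriv (fun r => t (p + r • EuclideanSpace.single 0 (1 : ℝ))) 0) *
          u (p + t p • EuclideanSpace.single 0 (1 : ℝ))
      = ∫⁻ q, ENNReal.ofReal (1 + seqDeriv (fun r => t (planarSplit.symm q +
            r • EuclideanSpace.single 0 (1 : ℝ))) 0) *
          u (planarSplit.symm q + t (planarSplit.symm q) • EuclideanSpace.single 0 (1 : ℝ))
            ∂((volume : Measure ℝ).prod volume) := by
        rw [← hsymm.lintegral_comp_emb planarSplit.symm.measurableEmbedding]
    _ = ∫⁻ q, ENNReal.ofReal (1 + seqDeriv (fun a => t' (a, q.2)) q.1) * u' (q.1 + t' q, q.2)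
            ∂((volume : Measure ℝ).prod volume) := lintegral_congr key
    _ = ∫⁻ q, u' q ∂((volume : Measure ℝ).prod volume) :=
        lintegral_shear_prod volume ht'm hL' hL1 hu'm
    _ = ∫⁻ p, u p := by
        rw [hu', ← hsymm.lintegral_comp_emb planarSplit.symm.measurableEmbedding]

end Literature.MeasureTheory.Lebesgue

end
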